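import Summits.QuantumFields.YangMills.Theorems.BalabanLadderNTConjugateResponse
import Summits.QuantumFields.YangMills.Theorems.BalabanLadderUVSeamRecFloorsEngineOfBareMirror
import HarnessLib

/-!
# Crux `UVSeamRec` (stmt-QuantumFields-20043), stub `stub_floorsEngine` (S-B), conjunct 2: CHECK-LEMMA — the
# registered statement from {BL6, CONJUGATE RESPONSE against any bounded positive-time witness, clause (ii)} at `rF`

Helper file (`--supports stmt-QuantumFields-20043`; owner RULINGS R78/R87) of the fleet lead `ym-spine-19353-p1`,
sequel of `…NTConjugateResponse` (general `(G, r)`): the asymptotic packaging along a unit map and the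
specialisation «last file» to `(SU(2), rF = fundamentalLatticeRep 2, a/uRec → c₀)`.
WHICH CLAUSE IT SUPPLIES: conjunct 2 (two-point floor) of the REGISTERED `UVSeamRec.stub_floorsEngine` through the
R87 residual MF(4ε), with MF itself DISCHARGED from the conjugate-response clauses of card
`rp-linearised-loop-response` rev 3.5 (crux-ideate seat `ym-cruxidea-19353-1`):

* (CR) per coupling `β ≥ β₅` a bounded continuous cylinder WITNESS `W_β` of links based at times in
  `[0, Λ₅/aβ − 1]`, `|W_β| ≤ K_β` (`K_β > 0`), and on every torus `2L+1` with `Λ₅ ≤ aβ·L` the unsigned response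
  `2√ε·K_β ≤ |Cov_T(Ṽ_v∘Θ₀, W_β)|`, `Ṽ_v = ∑_{y ∈ Q_β} v(aβ·y)·dens_y`.

By `ConjugateResponse.mirrorFloor_of_abs_response` (RP–Schwarz off the diagonal) (CR) gives MF(4ε) on every such
torus for `β ≥ max β₅ 0`; the rest is p517197/p518416:

* `bareFloors_of_conjugateResponse` — (CR) family ⇒ the MF(4ε) family (general `(G, r, a)`);
* `Q2_floor_of_conjugateResponse` / `floorsTwoPoint_of_conjugateResponse` — {RBLΔ, (CR)} ⇒ `Q2(θv, v) ≥ ε` for all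
  large couplings and tori / the compact-witness two-point conjunct (general `(G, r, a)`);
* `stubFloorsEngine_of_conjugateResponse_rF` — the REGISTERED v5(α)/v4-F `stub_floorsEngine` statement VERBATIM
  (`Cruxes/UVSeamRec/Lines/…`: `Transport.uRec`, `fundamentalLatticeRep 2`) from {unit clauses, BL6, (CR), clause
  (ii) supplier} = `MarkovMirrorFloors.stubFloorsEngine_of_bareFloor_rF` (p518416) with its (MF) conjunct replaced by
  (CR).  The witness family is ARBITRARY here; the card PINS it (clipped `v`-smeared coarse Lagrangian of Bałaban's
  iterated block field) and predicts the response from the unit-coefficient conjugacy of Bałaban's effective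
  densities — that evaluation is the engine's debt, not this file's.

HONEST FRAMING.  Bookkeeping on a conditional chain: (CR) for a pinned witness, BL6/FBL6 and clause (ii) are
engine-grade OPEN (crux `NT`; barrier `PerturbativeInvisibility`); nothing `SU(2)`-specific beyond the instantiation;
no `UV`, no two-point ceiling, no window is consumed; not a claim about NT or the gap.
[cite: FrohlichIsraelLiebSimon1978, Thm. 2.1]
-/

set_option autoImplicit false

noncomputable section

open scoped SchwartzMap
open MeasureTheory Filter Topology
open Literature.MathematicalPhysics.QuantumFieldTheory Literature.MathematicalPhysics.QuantumLattice
open Literature.Probability.LatticeModels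
open Summit.QuantumFields.YangMills.Cruxes.OSLegsFromFemtoAndGap.DlrCollarTransfer
open Summit.QuantumFields.YangMills.Cruxes.NT.MarkovMirror
open Summit.QuantumFields.YangMills.Cruxes.NT.ConjugateResponse (mirrorFloor_of_abs_response)

namespace Summit.QuantumFields.YangMills.Cruxes.UVSeamRec.ConjugateResponseFloors

/-! ## §1 Along a unit map: the (CR) family gives the MF(4ε) family (general `(G, r, a)`) -/

section General

variable (G : Type) [Group G] [TopologicalSpace G] [IsTopologicalGroup G] [CompactSpace G]
  [MeasurableSpace G] [BorelSpace G] (r : LatticeRep G)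

/-- **MF(4ε) on every large torus from the conjugate response, along a unit map** (general `(G, r, a)`).  A unit map
`a > 0`; for `β ≥ β₅` a cube `Q_β = (c β, b β)` at times `≥ 1` of physical size `(|c β j| + b β + 3)·aβ ≤ Λ₅`, a
weight `w β` on its sites (think `w β y = v(aβ·y)`), and a WITNESS `W β`: continuous, `|W β| ≤ K β` with `K β > 0`,
a cylinder function of links based at times `t` with `0 ≤ t`, `(t+1)·aβ ≤ Λ₅`; and the unsigned response
(CR) `2√ε·K β ≤ |Cov_T(Ṽ∘Θ₀, W β)|` on every torus `2L+1` with `Λ₅ ≤ aβ·L`, `Ṽ = ∑_{y ∈ Q_β} w β y · dens_y`, `ε ≥ 0`.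
Then MF(4ε) `4ε ≤ Cov_T(Ṽ∘Θ₀, Ṽ)` on every such torus for `β ≥ max β₅ 0` — the hypothesis shape of
`MarkovMirror.Q2_floor_of_bareFloor_chiral` (p517197). [cite: FrohlichIsraelLiebSimon1978, Thm. 2.1] -/
theorem bareFloors_of_conjugateResponse (a : ℝ → ℝ) (ha₀ : ∀ β, 0 < a β) {ε : ℝ} (hε : 0 ≤ ε) {β₅ Λ₅ : ℝ}
    (c : ℝ → (Fin 4 → ℤ)) (b : ℝ → ℕ) (w : ℝ → (Fin 4 → ℤ) → ℝ)
    (hgeom : ∀ β, β₅ ≤ β → 1 ≤ c β 0 ∧ ∀ j : Fin 4, (|((c β j : ℤ) : ℝ)| + (b β : ℝ) + 3) * a β ≤ Λ₅)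
    (K : ℝ → ℝ) (W : ℝ → LGConfig 4 G → ℝ)
    (S : ℝ → Finset (Literature.MathematicalPhysics.QuantumLattice.ZdEdge 4))
    (hW : ∀ β, β₅ ≤ β → 0 < K β ∧ Continuous (W β) ∧ (∀ U, |W β U| ≤ K β) ∧ IsCylinder (W β) (S β) ∧
      ∀ e ∈ S β, 0 ≤ e.1 0 ∧ (((e.1 0 : ℤ) : ℝ) + 1) * a β ≤ Λ₅)
    (hCR : ∀ β, β₅ ≤ β → ∀ L : ℕ, Λ₅ ≤ a β * L →
      2 * Real.sqrt ε * K β ≤ |torusE G r β L (fun V =>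
          (∑ y ∈ cubeSites (c β) (b β), w β y * dens G r y (cfgReflect V)) * W β V) -
        torusE G r β L (fun V => ∑ y ∈ cubeSites (c β) (b β), w β y * dens G r y V) * torusE G r β L (W β)|) :
    ∀ β : ℝ, max β₅ 0 ≤ β → ∀ L : ℕ, Λ₅ ≤ a β * L →
      4 * ε ≤ torusE G r β L (fun V =>
          (∑ y ∈ cubeSites (c β) (b β), w β y * dens G r y (cfgReflect V)) *
            ∑ y ∈ cubeSites (c β) (b β), w β y * dens G r y V) -
        torusE G r β L (fun V => ∑ y ∈ cubeSites (c β) (b β), w β y * dens G r y (cfgReflect V)) *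
          torusE G r β L (fun V => ∑ y ∈ cubeSites (c β) (b β), w β y * dens G r y V) := by
  intro β hβ L hL
  have hβ5 : β₅ ≤ β := le_of_max_le_left hβ
  have hβ0 : 0 ≤ β := le_of_max_le_right hβ
  have haβ := ha₀ β
  obtain ⟨hc1, hsize⟩ := hgeom β hβ5
  obtain ⟨hK, hWc, hWb, hWS, hwin⟩ := hW β hβ5
  -- the torus is large: `|c β 0| + b β + 3 ≤ L`
  have hcL : |((c β 0 : ℤ) : ℝ)| + (b β : ℝ) + 3 ≤ (L : ℝ) := by
    have h1 : (|((c β 0 : ℤ) : ℝ)| + (b β : ℝ) + 3) * a β ≤ (L : ℝ) * a β := by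
      have := hsize 0; rw [mul_comm (L : ℝ)]; linarith
    exact le_of_mul_le_mul_right h1 haβ
  -- the witness window lies in `[0, L−1]`
  have hSW : ∀ e ∈ S β, 0 ≤ e.1 0 ∧ e.1 0 + 1 ≤ (L : ℤ) := by
    intro e he
    have h0 := hwin e he
    refine ⟨h0.1, ?_⟩
    have h1 : (((e.1 0 : ℤ) : ℝ) + 1) * a β ≤ (L : ℝ) * a β := by rw [mul_comm (L : ℝ)]; linarith [h0.2]
    have h2 := le_of_mul_le_mul_right h1 haβ
    exact_mod_cast h2
  -- `c_R := 2√ε·K β`, `4εK² = c_R²`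
  have hcR : 0 ≤ 2 * Real.sqrt ε * K β := by positivity
  have hεK : 4 * ε * K β ^ 2 ≤ (2 * Real.sqrt ε * K β) ^ 2 := by
    have : (2 * Real.sqrt ε * K β) ^ 2 = 4 * (Real.sqrt ε) ^ 2 * K β ^ 2 := by ring
    rw [this, Real.sq_sqrt hε]
  exact mirrorFloor_of_abs_response G r hβ0 L (c β) (b β) hc1 hcL (w β) hWc hK hWb hWS hSW hcR hεK
    (hCR β hβ5 L hL)

/-- **`Q2(θv, v) ≥ ε` for all large couplings and tori from {RBLΔ, (CR)}** (general `(G, r, a)`): the hypotheses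
of `MarkovMirror.Q2_floor_of_bareFloor_chiral` (p517197) with the bare mirror floor (MF) REPLACED by the conjugate
response (CR) against a bounded positive-time witness family.  `ε > 0`; conclusion for `β ≥ max (max β₅ 0) 0`.
[cite: FrohlichIsraelLiebSimon1978, Thm. 2.1] -/
theorem Q2_floor_of_conjugateResponse (a : ℝ → ℝ) (ha₀ : ∀ β, 0 < a β)
    (v : 𝓢(EuclideanSpace ℝ (Fin 4), ℝ)) {ε : ℝ} (hε : 0 < ε) {β₅ Λ₅ : ℝ}
    (c : ℝ → (Fin 4 → ℤ)) (b : ℝ → ℕ) (p' : ℝ → ℝ)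
    (hgeom : ∀ β, β₅ ≤ β → 1 ≤ c β 0 ∧ ∀ j : Fin 4, (|((c β j : ℤ) : ℝ)| + (b β : ℝ) + 3) * a β ≤ Λ₅)
    (hsupp : ∀ β, β₅ ≤ β → ∀ x : Fin 4 → ℤ, v (a β • siteToE x) ≠ 0 →
      x ∈ cubeSites (c β) (b β) ∧ 2 ≤ depth (c β) (b β) x)
    (hΔ : ∀ β, β₅ ≤ β → ∀ ζ,
      |kerE G r β (c β) (b β) ζ (fun V => ∑ x ∈ cubeSites (c β) (b β), v (a β • siteToE x) *
          ∑ q : {q : Fin 4 × Fin 4 // q.1 < q.2}, plane G r q.1 (if q.1.1 = 0 then x - Pi.single 0 1 else x) V) -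
        kerE G r β (c β) (b β) ζ (fun V => ∑ y ∈ cubeSites (c β) (b β), v (a β • siteToE y) * dens G r y V) -
        p' β| ≤ Real.sqrt ε / 2)
    (K : ℝ → ℝ) (W : ℝ → LGConfig 4 G → ℝ)
    (S : ℝ → Finset (Literature.MathematicalPhysics.QuantumLattice.ZdEdge 4))
    (hW : ∀ β, β₅ ≤ β → 0 < K β ∧ Continuous (W β) ∧ (∀ U, |W β U| ≤ K β) ∧ IsCylinder (W β) (S β) ∧
      ∀ e ∈ S β, 0 ≤ e.1 0 ∧ (((e.1 0 : ℤ) : ℝ) + 1) * a β ≤ Λ₅)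
    (hCR : ∀ β, β₅ ≤ β → ∀ L : ℕ, Λ₅ ≤ a β * L →
      2 * Real.sqrt ε * K β ≤ |torusE G r β L (fun V =>
          (∑ y ∈ cubeSites (c β) (b β), v (a β • siteToE y) * dens G r y (cfgReflect V)) * W β V) -
        torusE G r β L (fun V => ∑ y ∈ cubeSites (c β) (b β), v (a β • siteToE y) * dens G r y V) *
          torusE G r β L (W β)|) :
    ∀ β : ℝ, max (max β₅ 0) 0 ≤ β → ∀ L : ℕ, Λ₅ ≤ a β * L → ε ≤ Q2 G r β L (a β) (thetaTest 4 v) v :=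
  Q2_floor_of_bareFloor_chiral G r a ha₀ v hε (β₅ := max β₅ 0) (Λ₅ := Λ₅) c b p'
    (fun β hβ => hgeom β (le_of_max_le_left hβ)) (fun β hβ => hsupp β (le_of_max_le_left hβ))
    (fun β hβ ζ => hΔ β (le_of_max_le_left hβ) ζ)
    (bareFloors_of_conjugateResponse G r a ha₀ hε.le c b (fun β y => v (a β • siteToE y)) hgeom K W S hW hCR)

/-- **The two-point conjunct of `UVSeamRec.stub_floorsEngine` from {RBLΔ, (CR)}** (compact support of the test
function recorded; general `(G, r, a)` — at `(SU(2), rF, a ≍ c₀·uRec)` it is the registered conjunct):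
`MarkovMirror.floorsTwoPoint_of_bareFloor_chiral` with (MF) replaced by the conjugate response (CR).
[cite: FrohlichIsraelLiebSimon1978, Thm. 2.1] -/
theorem floorsTwoPoint_of_conjugateResponse (a : ℝ → ℝ) (ha₀ : ∀ β, 0 < a β)
    (v : 𝓢(EuclideanSpace ℝ (Fin 4), ℝ)) (hvK : HasCompactSupport (v : EuclideanSpace ℝ (Fin 4) → ℝ))
    (hv : tsupport (v : EuclideanSpace ℝ (Fin 4) → ℝ) ⊆ {y | 0 < y 0})
    {ε : ℝ} (hε : 0 < ε) {β₅ Λ₅ : ℝ}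
    (c : ℝ → (Fin 4 → ℤ)) (b : ℝ → ℕ) (p' : ℝ → ℝ)
    (hgeom : ∀ β, β₅ ≤ β → 1 ≤ c β 0 ∧ ∀ j : Fin 4, (|((c β j : ℤ) : ℝ)| + (b β : ℝ) + 3) * a β ≤ Λ₅)
    (hsupp : ∀ β, β₅ ≤ β → ∀ x : Fin 4 → ℤ, v (a β • siteToE x) ≠ 0 →
      x ∈ cubeSites (c β) (b β) ∧ 2 ≤ depth (c β) (b β) x)
    (hΔ : ∀ β, β₅ ≤ β → ∀ ζ,
      |kerE G r β (c β) (b β) ζ (fun V => ∑ x ∈ cubeSites (c β) (b β), v (a β • siteToE x) *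
          ∑ q : {q : Fin 4 × Fin 4 // q.1 < q.2}, plane G r q.1 (if q.1.1 = 0 then x - Pi.single 0 1 else x) V) -
        kerE G r β (c β) (b β) ζ (fun V => ∑ y ∈ cubeSites (c β) (b β), v (a β • siteToE y) * dens G r y V) -
        p' β| ≤ Real.sqrt ε / 2)
    (K : ℝ → ℝ) (W : ℝ → LGConfig 4 G → ℝ)
    (S : ℝ → Finset (Literature.MathematicalPhysics.QuantumLattice.ZdEdge 4))
    (hW : ∀ β, β₅ ≤ β → 0 < K β ∧ Continuous (W β) ∧ (∀ U, |W β U| ≤ K β) ∧ IsCylinder (W β) (S β) ∧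
      ∀ e ∈ S β, 0 ≤ e.1 0 ∧ (((e.1 0 : ℤ) : ℝ) + 1) * a β ≤ Λ₅)
    (hCR : ∀ β, β₅ ≤ β → ∀ L : ℕ, Λ₅ ≤ a β * L →
      2 * Real.sqrt ε * K β ≤ |torusE G r β L (fun V =>
          (∑ y ∈ cubeSites (c β) (b β), v (a β • siteToE y) * dens G r y (cfgReflect V)) * W β V) -
        torusE G r β L (fun V => ∑ y ∈ cubeSites (c β) (b β), v (a β • siteToE y) * dens G r y V) *
          torusE G r β L (W β)|) :
    ∃ (v : 𝓢(EuclideanSpace ℝ (Fin 4), ℝ)) (ε β₅ Λ₅ : ℝ),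
      HasCompactSupport (v : EuclideanSpace ℝ (Fin 4) → ℝ) ∧
      tsupport (v : EuclideanSpace ℝ (Fin 4) → ℝ) ⊆ {y : EuclideanSpace ℝ (Fin 4) | 0 < y 0} ∧ 0 < ε ∧
      ∀ β : ℝ, β₅ ≤ β → ∀ L : ℕ, Λ₅ ≤ a β * L → ε ≤ Q2 G r β L (a β) (thetaTest 4 v) v :=
  ⟨v, ε, max (max β₅ 0) 0, Λ₅, hvK, hv, hε,
    Q2_floor_of_conjugateResponse G r a ha₀ v hε c b p' hgeom hsupp hΔ K W S hW hCR⟩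

end General

/-! ## §2 The REGISTERED `stub_floorsEngine` statement at `(SU(2), rF)` from {BL6, (CR), clause (ii)} -/

open Summit.QuantumFields.YangMills.Cruxes.UVSeamRec.MarkovMirrorFloors (stubFloorsEngine_of_bareFloor_rF)

/-- **CHECK-LEMMA: the REGISTERED v5(α)/v4-F `UVSeamRec.stub_floorsEngine` statement from the conjugate-response
package at `rF`.**  For `SU(2)` with its Borel σ-algebra: a unit map `a > 0` with `a β / uRec β → c₀ > 0`; ONE
compactly supported positive-time `v`, `ε > 0`, `κ > 0`, `C₁ ≥ 0`; per coupling `β ≥ β₅` a positive-time cube `Q_β`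
of physical size `≤ Λ₅` carrying the lattice support of `v(aβ·)` at depth `≥ 2` and its `e₀`-thickening at physical
depth `≥ κ`; (BL6) the one-plaquette boundary law `C₁/depth⁴` on the thickened support for every exterior;
a WITNESS family `W_β` (continuous, `|W_β| ≤ K_β`, `K_β > 0`, cylinder in links at times `t ≥ 0` with
`(t+1)·aβ ≤ Λ₅`) with the unsigned CONJUGATE RESPONSE (CR) `2√ε·K_β ≤ |Cov_T(Ṽ_v∘Θ₀, W_β)|` on every torus
`aβ·L ≥ Λ₅`; and any supplier of the compact-witness three-point conjunct.  Then the statement of `stub_floorsEngine`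
holds — `MarkovMirrorFloors.stubFloorsEngine_of_bareFloor_rF` (p518416) with its (MF) conjunct discharged by
`bareFloors_of_conjugateResponse` (restricting to `β ≥ max β₅ 0` for reflection positivity).
[cite: FrohlichIsraelLiebSimon1978, Thm. 2.1] -/
theorem stubFloorsEngine_of_conjugateResponse_rF
    (h : letI : MeasurableSpace (Matrix.specialUnitaryGroup (Fin 2) ℂ) := borel _
      haveI : BorelSpace (Matrix.specialUnitaryGroup (Fin 2) ℂ) := ⟨rfl⟩
      ∃ (a : ℝ → ℝ) (c₀ : ℝ), 0 < c₀ ∧ (∀ β, 0 < a β) ∧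
        Tendsto (fun β => a β / Transport.uRec β) atTop (𝓝 c₀) ∧
      (∃ (v : 𝓢(EuclideanSpace ℝ (Fin 4), ℝ)) (ε β₅ Λ₅ κ C₁ : ℝ) (c : ℝ → (Fin 4 → ℤ)) (b : ℝ → ℕ)
          (p6 : ℝ → {q : Fin 4 × Fin 4 // q.1 < q.2} → ℝ) (K : ℝ → ℝ)
          (W : ℝ → LGConfig 4 (Matrix.specialUnitaryGroup (Fin 2) ℂ) → ℝ)
          (S : ℝ → Finset (Literature.MathematicalPhysics.QuantumLattice.ZdEdge 4)),
          HasCompactSupport (v : EuclideanSpace ℝ (Fin 4) → ℝ) ∧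
          tsupport (v : EuclideanSpace ℝ (Fin 4) → ℝ) ⊆ {y | 0 < y 0} ∧ 0 < ε ∧ 0 < κ ∧ 0 ≤ C₁ ∧
          (∀ β, β₅ ≤ β → 1 ≤ c β 0 ∧ ∀ j : Fin 4, (|((c β j : ℤ) : ℝ)| + (b β : ℝ) + 3) * a β ≤ Λ₅) ∧
          (∀ β, β₅ ≤ β → ∀ x : Fin 4 → ℤ, v (a β • siteToE x) ≠ 0 →
            x ∈ cubeSites (c β) (b β) ∧ 2 ≤ depth (c β) (b β) x) ∧
          (∀ β, β₅ ≤ β → ∀ x : Fin 4 → ℤ,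
            (v (a β • siteToE x) ≠ 0 ∨ v (a β • siteToE (x + Pi.single 0 1)) ≠ 0) →
              x ∈ cubeSites (c β) (b β) ∧ κ / a β ≤ (depth (c β) (b β) x : ℝ)) ∧
          (∀ β, β₅ ≤ β → ∀ (ζ : LGConfig 4 (Matrix.specialUnitaryGroup (Fin 2) ℂ))
            (q : {q : Fin 4 × Fin 4 // q.1 < q.2}), q.1.1 = 0 → ∀ x ∈ cubeSites (c β) (b β),
              (v (a β • siteToE x) ≠ 0 ∨ v (a β • siteToE (x + Pi.single 0 1)) ≠ 0) →
                |kerE (Matrix.specialUnitaryGroup (Fin 2) ℂ) (fundamentalLatticeRep 2) β (c β) (b β) ζ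
                    (plane (Matrix.specialUnitaryGroup (Fin 2) ℂ) (fundamentalLatticeRep 2) q.1 x) - p6 β q| ≤
                  C₁ / (depth (c β) (b β) x : ℝ) ^ 4) ∧
          (∀ β, β₅ ≤ β → 0 < K β ∧ Continuous (W β) ∧ (∀ U, |W β U| ≤ K β) ∧ IsCylinder (W β) (S β) ∧
            ∀ e ∈ S β, 0 ≤ e.1 0 ∧ (((e.1 0 : ℤ) : ℝ) + 1) * a β ≤ Λ₅) ∧
          (∀ β, β₅ ≤ β → ∀ L : ℕ, Λ₅ ≤ a β * L →
            2 * Real.sqrt ε * K β ≤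
              |torusE (Matrix.specialUnitaryGroup (Fin 2) ℂ) (fundamentalLatticeRep 2) β L (fun V =>
                  (∑ y ∈ cubeSites (c β) (b β), v (a β • siteToE y) *
                      dens (Matrix.specialUnitaryGroup (Fin 2) ℂ) (fundamentalLatticeRep 2) y (cfgReflect V)) *
                    W β V) -
                torusE (Matrix.specialUnitaryGroup (Fin 2) ℂ) (fundamentalLatticeRep 2) β L (fun V =>
                    ∑ y ∈ cubeSites (c β) (b β), v (a β • siteToE y) *
                      dens (Matrix.specialUnitaryGroup (Fin 2) ℂ) (fundamentalLatticeRep 2) y V) *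
                  torusE (Matrix.specialUnitaryGroup (Fin 2) ℂ) (fundamentalLatticeRep 2) β L (W β)|)) ∧
      (∃ (f g h : 𝓢(EuclideanSpace ℝ (Fin 4), ℝ)) (ε β₅ Λ₅ : ℝ),
        HasCompactSupport (f : EuclideanSpace ℝ (Fin 4) → ℝ) ∧
        HasCompactSupport (g : EuclideanSpace ℝ (Fin 4) → ℝ) ∧
        HasCompactSupport (h : EuclideanSpace ℝ (Fin 4) → ℝ) ∧
        Disjoint (tsupport (f : EuclideanSpace ℝ (Fin 4) → ℝ)) (tsupport (g : EuclideanSpace ℝ (Fin 4) → ℝ)) ∧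
        Disjoint (tsupport (g : EuclideanSpace ℝ (Fin 4) → ℝ)) (tsupport (h : EuclideanSpace ℝ (Fin 4) → ℝ)) ∧
        Disjoint (tsupport (f : EuclideanSpace ℝ (Fin 4) → ℝ)) (tsupport (h : EuclideanSpace ℝ (Fin 4) → ℝ)) ∧
        0 < ε ∧ ∀ β : ℝ, β₅ ≤ β → ∀ L : ℕ, Λ₅ ≤ a β * L →
          ε ≤ |Q3 (Matrix.specialUnitaryGroup (Fin 2) ℂ) (fundamentalLatticeRep 2) β L (a β) f g h|)) :
    letI : MeasurableSpace (Matrix.specialUnitaryGroup (Fin 2) ℂ) := borel _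
    haveI : BorelSpace (Matrix.specialUnitaryGroup (Fin 2) ℂ) := ⟨rfl⟩
    ∃ (a : ℝ → ℝ) (c₀ : ℝ), 0 < c₀ ∧ (∀ β, 0 < a β) ∧
      Tendsto (fun β => a β / Transport.uRec β) atTop (𝓝 c₀) ∧
      (∃ (v : 𝓢(EuclideanSpace ℝ (Fin 4), ℝ)) (ε β₅ Λ₅ : ℝ),
        HasCompactSupport (v : EuclideanSpace ℝ (Fin 4) → ℝ) ∧
        tsupport (v : EuclideanSpace ℝ (Fin 4) → ℝ) ⊆ {y : EuclideanSpace ℝ (Fin 4) | 0 < y 0} ∧ 0 < ε ∧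
        ∀ β : ℝ, β₅ ≤ β → ∀ L : ℕ, Λ₅ ≤ a β * L →
          ε ≤ Q2 (Matrix.specialUnitaryGroup (Fin 2) ℂ) (fundamentalLatticeRep 2) β L (a β) (thetaTest 4 v) v) ∧
      (∃ (f g h : 𝓢(EuclideanSpace ℝ (Fin 4), ℝ)) (ε β₅ Λ₅ : ℝ),
        HasCompactSupport (f : EuclideanSpace ℝ (Fin 4) → ℝ) ∧
        HasCompactSupport (g : EuclideanSpace ℝ (Fin 4) → ℝ) ∧
        HasCompactSupport (h : EuclideanSpace ℝ (Fin 4) → ℝ) ∧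
        Disjoint (tsupport (f : EuclideanSpace ℝ (Fin 4) → ℝ)) (tsupport (g : EuclideanSpace ℝ (Fin 4) → ℝ)) ∧
        Disjoint (tsupport (g : EuclideanSpace ℝ (Fin 4) → ℝ)) (tsupport (h : EuclideanSpace ℝ (Fin 4) → ℝ)) ∧
        Disjoint (tsupport (f : EuclideanSpace ℝ (Fin 4) → ℝ)) (tsupport (h : EuclideanSpace ℝ (Fin 4) → ℝ)) ∧
        0 < ε ∧ ∀ β : ℝ, β₅ ≤ β → ∀ L : ℕ, Λ₅ ≤ a β * L →
          ε ≤ |Q3 (Matrix.specialUnitaryGroup (Fin 2) ℂ) (fundamentalLatticeRep 2) β L (a β) f g h|) := by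
  letI : MeasurableSpace (Matrix.specialUnitaryGroup (Fin 2) ℂ) := borel _
  haveI : BorelSpace (Matrix.specialUnitaryGroup (Fin 2) ℂ) := ⟨rfl⟩
  obtain ⟨a, c₀, hc₀, ha₀, hau, ⟨v, ε, β₅, Λ₅, κ, C₁, c, b, p6, K, W, S, hvK, hv, hε, hκ, hC₁, hgeom, hsupp, hthick,
    hBL, hW, hCR⟩, h3⟩ := h
  have hMF := bareFloors_of_conjugateResponse (Matrix.specialUnitaryGroup (Fin 2) ℂ) (fundamentalLatticeRep 2) a
    ha₀ hε.le c b (fun β y => v (a β • siteToE y)) hgeom K W S hW hCR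
  exact stubFloorsEngine_of_bareFloor_rF ⟨a, c₀, hc₀, ha₀, hau, ⟨v, ε, max β₅ 0, Λ₅, κ, C₁, c, b, p6, hvK, hv,
    hε, hκ, hC₁, fun β hβ => hgeom β (le_of_max_le_left hβ), fun β hβ => hsupp β (le_of_max_le_left hβ),
    fun β hβ => hthick β (le_of_max_le_left hβ), fun β hβ => hBL β (le_of_max_le_left hβ), hMF⟩, h3⟩

end Summit.QuantumFields.YangMills.Cruxes.UVSeamRec.ConjugateResponseFloors

end
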